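import Literature.MathematicalPhysics.QuantumLattice.SchwingerOSAxioms
import Literature.MathematicalPhysics.QuantumLattice.OSMomentBounds
import Literature.MathematicalPhysics.QuantumLattice.SchwartzReIm
import HarnessLib

/-!
# Growth of Schwinger functions: E0'' for OS measures and the bridge E0'' ⇒ E0'

Trunk **T-AQFT** (topic `MathematicalPhysics/QuantumLattice`), families `constructive-qft`,
`crit-ising`; part of the decomposition of the bridge `Literature.MathematicalPhysics.QuantumLattice.IsOSMeasure.exists_isOSFamily'`
(`QuantumFieldTheory/OSAxioms`, constructive-qft.S06), whose last conjunct asserts the linear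
growth condition E0' (`SchwingerFamily.HasLinearGrowth`, OS II) for the Schwinger functions of an
OS measure.

Osterwalder–Schrader II [OS 1975, §IV.1] introduce, next to E0'
(`|𝔖ₙ(f)| ≤ σₙ |f|_{ns}`, `σₙ` of factorial growth, (4.1)), the "slightly stronger" product form

  (E0'') `|𝔖ₙ(f₁ ⊗ ⋯ ⊗ fₙ)| ≤ σₙ ∏ᵢ |fᵢ|_s` for all `fᵢ ∈ 𝒮`, `σₙ ≤ α (n!)^β` (4.2),

and prove in the Appendix (by S. Summers, pp. 303–305, Hermite expansion) that E0'' implies E0'.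
For the moments of a measure, E0'' is exactly what the regularity axiom OS1 delivers:
Glimm–Jaffe [1987, §19.1], Prop. 19.1.1 (moments continuous in `‖f‖_{L₁} + ‖f‖_{L_p}`) and the
Remark after Prop. 19.1.2 (`|∫ φ(f)ʳ dμ| ≤ (c‖f‖)ʳ r!^q`). Accordingly this file

* defines `SchwingerFamily.HasProductGrowth` (E0'', OS II (4.2));
* records the named fact `SchwingerFamily.HasProductGrowth.hasLinearGrowth` (E0'' ⇒ E0',
  OS II Appendix; its proof needs the Hermite expansion of tempered distributions, absent from
  Mathlib);
* PROVES E0'' for the Schwinger functions of any probability measure with exponential moments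
  satisfying OS1 (`IsSchwingerFamilyOf.hasProductGrowth`, `IsOSMeasure.hasProductGrowth`), from
  the moment bound `IsOS1Regular.integral_abs_pow_eval_le` (`OSMomentBounds`), the domination of
  `L¹`/`Lᵖ` norms by Schwartz norms (`exists_integral_abs_le_schwartzNorm`, Mathlib
  `SchwartzMap.eLpNorm_le_seminorm`), homogeneity, `∏|xᵢ| ≤ 1 + ∑|xᵢ|ⁿ`, and the expansion of a
  complex tensor product into `2ⁿ` real ones (`eq_sum_tensorFin_reIm`, `SchwartzReIm`). The
  resulting constants are `σₙ = 2ⁿ (1 + 2n e^{2|c|} n! Kⁿ) ≤ (e² + 2e^{2|c|} e^{4K}) (n!)²`.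

## Sources

* K. Osterwalder, R. Schrader, *Axioms for Euclidean Green's functions II*, Comm. Math. Phys.
  42 (1975) 281–305: §IV.1, (4.1) E0', (4.2) E0'', Remark 1 p. 287; Appendix (S. Summers),
  pp. 303–305, Theorem "E0'' implies E0'". [OsterwalderSchraderCMP1975]
* J. Glimm, A. Jaffe, *Quantum Physics: a functional integral point of view*, 2nd ed. (1987),
  §19.1: Prop. 19.1.1 (p. 302), Prop. 19.1.2 and Remark (pp. 302–303). [GlimmJaffeQP1987]

## Mathlib

Used: `SchwartzMap.eLpNorm_le_seminorm`, `SchwartzMap.norm_toLp`, `Real.pow_div_factorial_le_exp`,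
`Finset.prod_le_prod`, `Fintype.card_finset`. Searched and absent at the pin: Hermite functions
as a basis of `L²`/`𝓢` (`hermite` only as polynomials, `Mathlib/RingTheory/Polynomial/Hermite`),
any growth statement for distributions on tensor products.
-/

open scoped SchwartzMap ComplexConjugate
open MeasureTheory Filter Topology Complex

noncomputable section


namespace Literature.MathematicalPhysics.QuantumLattice

/-! ### `Lᵖ` norms are controlled by Schwartz norms -/

section LpControl

variable {d : ℕ}

/-- **`L¹` and `Lᵖ` norms are dominated by a Schwartz norm** (Mathlib
`SchwartzMap.eLpNorm_le_seminorm`, repackaged): for real `p ≥ 1` there are an order `s` and a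
constant `K > 0` with `∫|f| ≤ K |f|_s` and `∫|f|ᵖ ≤ (K |f|_s)ᵖ` for all real test functions `f`
on `ℝ^d` (`|f|_s = schwartzNorm s (ofRealTest f)`). This is the comparison
`‖f‖_{L₁} + ‖f‖_{L_p} ≤ const |f|_s` between Glimm–Jaffe's norm (19.1.1) and the Schwartz norms
of OS II §2. [folklore] -/
theorem exists_integral_abs_le_schwartzNorm {p : ℝ} (hp : 1 ≤ p) :
    ∃ (s : ℕ) (K : ℝ), 0 < K ∧ ∀ f : 𝓢(EuclideanSpace ℝ (Fin d), ℝ),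
      (∫ x, |f x|) ≤ K * schwartzNorm s (ofRealTest f) ∧
        (∫ x, |f x| ^ p) ≤ (K * schwartzNorm s (ofRealTest f)) ^ p := by
  have hp0 : 0 < p := lt_of_lt_of_le one_pos hp
  obtain ⟨k₁, C₁, h₁⟩ := SchwartzMap.eLpNorm_le_seminorm ℝ ℝ (1 : ENNReal)
    (volume : Measure (EuclideanSpace ℝ (Fin d)))
  obtain ⟨k₂, C₂, h₂⟩ := SchwartzMap.eLpNorm_le_seminorm ℝ ℝ (ENNReal.ofReal p)
    (volume : Measure (EuclideanSpace ℝ (Fin d)))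
  refine ⟨max k₁ k₂, max (max (C₁ : ℝ) C₂) 1, lt_of_lt_of_le one_pos (le_max_right _ _), fun f => ?_⟩
  set K : ℝ := max (max (C₁ : ℝ) C₂) 1 with hK
  set M : ℝ := schwartzNorm (max k₁ k₂) (ofRealTest f) with hM
  have hM0 : 0 ≤ M := schwartzNorm_nonneg _ _
  have hK1 : (C₁ : ℝ) ≤ K := (le_max_left _ _).trans (le_max_left _ _)
  have hK2 : (C₂ : ℝ) ≤ K := (le_max_right _ _).trans (le_max_left _ _)
  have hsup₁ : (Finset.Iic (k₁, 0)).sup (schwartzSeminormFamily ℝ _ ℝ) f ≤ M :=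
    (sup_seminorm_le_schwartzNorm k₁ f).trans (schwartzNorm_mono (le_max_left _ _) _)
  have hsup₂ : (Finset.Iic (k₂, 0)).sup (schwartzSeminormFamily ℝ _ ℝ) f ≤ M :=
    (sup_seminorm_le_schwartzNorm k₂ f).trans (schwartzNorm_mono (le_max_right _ _) _)
  -- `L¹`
  have hL1 : eLpNorm f 1 (volume : Measure (EuclideanSpace ℝ (Fin d))) ≤ ENNReal.ofReal (C₁ * M) := by
    refine (h₁ f).trans ?_
    rw [ENNReal.ofReal_mul C₁.coe_nonneg, ENNReal.ofReal_coe_nnreal]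
    gcongr
  have hI1 : ∫ x, |f x| ≤ K * M := by
    rw [integral_abs_eq_norm_toLp, SchwartzMap.norm_toLp]
    calc (eLpNorm f 1 (volume : Measure (EuclideanSpace ℝ (Fin d)))).toReal ≤ C₁ * M :=
          ENNReal.toReal_le_of_le_ofReal (mul_nonneg C₁.coe_nonneg hM0) hL1
      _ ≤ K * M := mul_le_mul_of_nonneg_right hK1 hM0
  -- `Lᵖ`
  have hLp : eLpNorm f (ENNReal.ofReal p) (volume : Measure (EuclideanSpace ℝ (Fin d))) ≤
      ENNReal.ofReal (C₂ * M) := by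
    refine (h₂ f).trans ?_
    rw [ENNReal.ofReal_mul C₂.coe_nonneg, ENNReal.ofReal_coe_nnreal]
    gcongr
  have hIp : ∫ x, |f x| ^ p ≤ (K * M) ^ p := by
    rw [integral_abs_rpow_eq_norm_toLp_rpow hp0, SchwartzMap.norm_toLp]
    refine Real.rpow_le_rpow ENNReal.toReal_nonneg ?_ hp0.le
    calc (eLpNorm f (ENNReal.ofReal p) (volume : Measure (EuclideanSpace ℝ (Fin d)))).toReal
        ≤ C₂ * M := ENNReal.toReal_le_of_le_ofReal (mul_nonneg C₂.coe_nonneg hM0) hLp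
      _ ≤ K * M := mul_le_mul_of_nonneg_right hK2 hM0
  exact ⟨hI1, hIp⟩

end LpControl

/-! ### E0'': product growth of Schwinger functions -/

namespace SchwingerFamily

variable {E : Type*} [NormedAddCommGroup E] [NormedSpace ℝ E]

/-- **(E0'') Product growth condition** (Osterwalder–Schrader II, CMP 42 (1975), §IV.1, (4.2)):
there exist an order `s` and a sequence `σₙ` of factorial growth (`σₙ ≤ α (n!)^β`) such that
`|𝔖ₙ(φ₁ ⊗ ⋯ ⊗ φₙ)| ≤ σₙ ∏ᵢ |φᵢ|_s` for all one-point (complex) test functions `φ₁, …, φₙ`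
(tensor products via the witness predicate `IsTensorOf`; `|·|_s = schwartzNorm s`). OS II print
E0'' together with `𝔖₀ = 1` and `𝔖ₙ ∈ 𝒮'`; the normalisation is kept separate
(`IsNormalized`) as for `HasLinearGrowth` (E0'). "Slightly stronger than E0'": E0'' ⇒ E0'
(OS II, Remark 1 p. 287 and Appendix). [cite: OsterwalderSchraderCMP1975, §IV.1 (4.2)] -/
def HasProductGrowth (S : SchwingerFamily E) : Prop :=
  ∃ (s : ℕ) (σ : ℕ → ℝ) (α β : ℝ), (∀ n, σ n ≤ α * (n.factorial : ℝ) ^ β) ∧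
    ∀ (n : ℕ) (φ : Fin n → 𝓢(E, ℂ)) (F : 𝓢((Fin n → E), ℂ)), IsTensorOf F φ →
      ‖S n F‖ ≤ σ n * ∏ i, schwartzNorm s (φ i)

/-- **E0'' implies E0'** (Osterwalder–Schrader II, CMP 42 (1975): Remark 1 after Theorem
`E' (or E'') → R'`, p. 287, "as E0'' implies E0' (see Appendix)", and the Appendix by
S. Summers, pp. 303–305, Theorem "Condition E0'' implies E0'": if `T ∈ 𝒮'(ℝ^{4n})` satisfies
`|T(h₁ ⊗ ⋯ ⊗ hₙ)| ≤ cⁿ ∏ |hᵢ|_r` for all `hᵢ ∈ 𝒮(ℝ⁴)` then `|T(g)| ≤ c'ⁿ |g|_{n t}` for all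
`g ∈ 𝒮(ℝ^{4n})`, `t = 2r + 7`, proved by a Hermite expansion of `T`). Stated for a
finite-dimensional one-point space `E` (the printed `ℝ⁴`; the argument is dimension-independent
up to the values of `t` and `c'`). Known theorem; proof deferred (it needs the Hermite expansion
of tempered distributions, absent from Mathlib). [cite: OsterwalderSchraderCMP1975, Appendix (S. Summers), Theorem E0'' ⇒ E0', pp. 303–305] -/
def HasProductGrowth.hasLinearGrowth : Prop :=
  ∀ [FiniteDimensional ℝ E] {S : SchwingerFamily E}, S.HasProductGrowth → S.HasLinearGrowth

end SchwingerFamily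

/-! ### OS measures satisfy E0'' -/

section Measure

variable {d : ℕ} {μ : Measure (FieldConfig (EuclideanSpace ℝ (Fin d)))} {p c : ℝ}

/-- **The Schwinger functions of a measure with exponential moments and OS1 satisfy the product
growth condition E0''** with `σₙ` of factorial growth: from the moment bound
`∫|ω(h)|ⁿ ≤ 2e^{2|c|} n! Kⁿ` for `|h|_s ≤ 1` (`IsOS1Regular.integral_abs_pow_eval_le` and
`exists_integral_abs_le_schwartzNorm`), homogeneity, `∏|xᵢ| ≤ 1 + ∑|xᵢ|ⁿ`, and the expansion of
complex tensor products into `2ⁿ` real ones. This is Glimm–Jaffe's bound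
`|∫ φ(f)ʳ dμ| ≤ (c‖f‖)ʳ r!^q` (Remark after Prop. 19.1.2, p. 303) polarised to distinct factors,
i.e. E0'' of OS II (4.2) for the moments (6.1.15). [cite: GlimmJaffeQP1987, §19.1 Prop. 19.1.1–19.1.2] -/
theorem IsSchwingerFamilyOf.hasProductGrowth [IsProbabilityMeasure μ]
    {S : SchwingerFamily (EuclideanSpace ℝ (Fin d))} (hS : IsSchwingerFamilyOf μ S)
    (h1 : IsOS1Regular μ p c) (hexp : HasExponentialMoments μ) : S.HasProductGrowth := by
  have hall : HasAllMoments μ := HasExponentialMoments.hasAllMoments_holds hexp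
  obtain ⟨s, K, hK, hLK⟩ := exists_integral_abs_le_schwartzNorm (d := d) h1.1
  -- the real bound
  set B : ℕ → ℝ := fun n => 1 + n * (2 * Real.exp (2 * |c|) * n.factorial * K ^ n) with hB
  have hB0 : ∀ n, 0 ≤ B n := fun n => by positivity
  have hunit : ∀ (n : ℕ) (u : 𝓢(EuclideanSpace ℝ (Fin d), ℝ)), schwartzNorm s (ofRealTest u) = 1 →
      ∫ ω, |ω u| ^ n ∂μ ≤ 2 * Real.exp (2 * |c|) * n.factorial * K ^ n := by
    intro n u hu
    have h := hLK u
    rw [hu, mul_one] at h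
    exact h1.integral_abs_pow_eval_le hexp u hK h.1 h.2 n
  have hreal : ∀ (n : ℕ) (f : Fin n → 𝓢(EuclideanSpace ℝ (Fin d), ℝ)),
      |moment μ n f| ≤ B n * ∏ i, schwartzNorm s (ofRealTest (f i)) := by
    intro n f
    set N : Fin n → ℝ := fun i => schwartzNorm s (ofRealTest (f i)) with hN
    have hN0 : ∀ i, 0 ≤ N i := fun i => schwartzNorm_nonneg _ _
    by_cases hz : ∃ i, N i = 0
    · obtain ⟨i, hi⟩ := hz
      have hfi : f i = 0 := eq_zero_of_schwartzNorm_ofRealTest_eq_zero hi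
      have hm : moment μ n f = 0 := by
        unfold moment
        refine (integral_congr_ae (ae_of_all _ fun ω => ?_)).trans (integral_zero _ _)
        exact Finset.prod_eq_zero (Finset.mem_univ i) (by rw [hfi, map_zero])
      rw [hm, abs_zero]
      exact mul_nonneg (hB0 n) (Finset.prod_nonneg fun i _ => hN0 i)
    push Not at hz
    have hNpos : ∀ i, 0 < N i := fun i => lt_of_le_of_ne (hN0 i) (Ne.symm (hz i))
    let u : Fin n → 𝓢(EuclideanSpace ℝ (Fin d), ℝ) := fun i => (N i)⁻¹ • f i
    have hu1 : ∀ i, schwartzNorm s (ofRealTest (u i)) = 1 := by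
      intro i
      simp only [u]
      rw [schwartzNorm_ofRealTest_smul, abs_of_pos (inv_pos.2 (hNpos i)), inv_mul_cancel₀ (hNpos i).ne']
    have hfu : ∀ i (ω : FieldConfig (EuclideanSpace ℝ (Fin d))), ω (f i) = N i * ω (u i) := by
      intro i ω
      simp only [u, map_smul, smul_eq_mul]
      rw [← mul_assoc, mul_inv_cancel₀ (hNpos i).ne', one_mul]
    have hmom : moment μ n f = (∏ i, N i) * moment μ n u := by
      unfold moment
      rw [← integral_const_mul]
      refine integral_congr_ae (ae_of_all _ fun ω => ?_)
      simp only [hfu, Finset.prod_mul_distrib]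
    have hmu : |moment μ n u| ≤ B n := by
      unfold moment
      calc |∫ ω, ∏ i, ω (u i) ∂μ| ≤ ∫ ω, |∏ i, ω (u i)| ∂μ := abs_integral_le_integral_abs
        _ = ∫ ω, ∏ i, |ω (u i)| ∂μ := by simp_rw [Finset.abs_prod]
        _ ≤ ∫ ω, (1 + ∑ i, |ω (u i)| ^ n) ∂μ := by
            refine integral_mono (hall.integrable_prod_abs u)
              ((integrable_const _).add (integrable_finsetSum _ fun i _ => hall.integrable_abs_pow _ _))
              fun ω => ?_
            exact prod_le_one_add_sum_pow (fun i => |ω (u i)|) fun i => abs_nonneg _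
        _ = 1 + ∑ i, ∫ ω, |ω (u i)| ^ n ∂μ := by
            rw [integral_add (integrable_const _) (integrable_finsetSum _ fun i _ => hall.integrable_abs_pow _ _),
              integral_finsetSum _ fun i _ => hall.integrable_abs_pow _ _]
            simp
        _ ≤ 1 + ∑ _i : Fin n, 2 * Real.exp (2 * |c|) * n.factorial * K ^ n := by
            gcongr with i
            exact hunit n (u i) (hu1 i)
        _ = B n := by simp [hB]
    rw [hmom, abs_mul, abs_of_nonneg (Finset.prod_nonneg fun i _ => hN0 i), mul_comm]
    exact mul_le_mul_of_nonneg_right hmu (Finset.prod_nonneg fun i _ => hN0 i)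
  -- the complex bound
  refine ⟨s, fun n => 2 ^ n * B n, Real.exp 2 + 2 * Real.exp (2 * |c|) * Real.exp (4 * K), 2, ?_, ?_⟩
  · intro n
    have hfac : (1 : ℝ) ≤ n.factorial := by exact_mod_cast Nat.one_le_iff_ne_zero.2 (Nat.factorial_ne_zero n)
    have hfpos : (0 : ℝ) < n.factorial := by positivity
    have h2n : (2 : ℝ) ^ n ≤ Real.exp 2 * n.factorial := by
      have h := Real.pow_div_factorial_le_exp (2 : ℝ) zero_le_two n
      rwa [div_le_iff₀ hfpos] at h
    have hnK : (2 : ℝ) ^ n * (n * K ^ n) ≤ Real.exp (4 * K) * n.factorial := by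
      have h := Real.pow_div_factorial_le_exp (4 * K) (by positivity) n
      rw [div_le_iff₀ hfpos] at h
      have hn2 : (n : ℝ) ≤ 2 ^ n := by exact_mod_cast Nat.lt_two_pow_self.le
      calc (2 : ℝ) ^ n * (n * K ^ n) ≤ 2 ^ n * (2 ^ n * K ^ n) := by gcongr
        _ = (4 * K) ^ n := by rw [show (4 : ℝ) * K = 2 * (2 * K) by ring, mul_pow, mul_pow]
        _ ≤ Real.exp (4 * K) * n.factorial := h
    rw [Real.rpow_two]
    calc (2 : ℝ) ^ n * B n
        = 2 ^ n + 2 * Real.exp (2 * |c|) * n.factorial * (2 ^ n * (n * K ^ n)) := by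
          simp only [hB]; ring
      _ ≤ Real.exp 2 * n.factorial + 2 * Real.exp (2 * |c|) * n.factorial * (Real.exp (4 * K) * n.factorial) := by
          gcongr
      _ ≤ Real.exp 2 * (n.factorial * n.factorial) +
            2 * Real.exp (2 * |c|) * n.factorial * (Real.exp (4 * K) * n.factorial) := by
          gcongr
          exact le_mul_of_one_le_right hfpos.le hfac
      _ = (Real.exp 2 + 2 * Real.exp (2 * |c|) * Real.exp (4 * K)) * (n.factorial : ℝ) ^ 2 := by ring
  · intro n φ F hF
    let ψ : Finset (Fin n) → Fin n → 𝓢(EuclideanSpace ℝ (Fin d), ℝ) :=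
      fun t i => if i ∈ t then reTest (φ i) else imTest (φ i)
    let T : Finset (Fin n) → 𝓢((Fin n → EuclideanSpace ℝ (Fin d)), ℂ) :=
      fun t => SchwartzMap.tensorFin n (fun i => ofRealTest (ψ t i))
    have hFT : F = ∑ t : Finset (Fin n), (I ^ (n - t.card)) • T t := by
      have h := eq_sum_tensorFin_reIm φ F hF
      simpa only [T, ψ, apply_ite ofRealTest] using h
    have hψ : ∀ t i, schwartzNorm s (ofRealTest (ψ t i)) ≤ schwartzNorm s (φ i) := by
      intro t i
      simp only [ψ]
      split_ifs
      · exact schwartzNorm_ofRealTest_reTest_le s (φ i)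
      · exact schwartzNorm_ofRealTest_imTest_le s (φ i)
    have hT : ∀ t, ‖S n (T t)‖ ≤ B n * ∏ i, schwartzNorm s (φ i) := by
      intro t
      rw [hS n (ψ t) (T t) (isTensorOf_tensorFin _), Complex.norm_real, Real.norm_eq_abs]
      refine (hreal n (ψ t)).trans (mul_le_mul_of_nonneg_left ?_ (hB0 n))
      exact Finset.prod_le_prod (fun i _ => schwartzNorm_nonneg _ _) fun i _ => hψ t i
    calc ‖S n F‖ = ‖∑ t : Finset (Fin n), (I ^ (n - t.card)) • S n (T t)‖ := by
          rw [hFT, map_sum]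
          simp_rw [map_smul]
      _ ≤ ∑ t : Finset (Fin n), ‖(I ^ (n - t.card)) • S n (T t)‖ := norm_sum_le _ _
      _ = ∑ t : Finset (Fin n), ‖S n (T t)‖ := by
          refine Finset.sum_congr rfl fun t _ => ?_
          rw [norm_smul, norm_pow, Complex.norm_I, one_pow, one_mul]
      _ ≤ ∑ _t : Finset (Fin n), B n * ∏ i, schwartzNorm s (φ i) := Finset.sum_le_sum fun t _ => hT t
      _ = 2 ^ n * B n * ∏ i, schwartzNorm s (φ i) := by
          rw [Finset.sum_const, Finset.card_univ, Fintype.card_finset, Fintype.card_fin, nsmul_eq_mul]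
          push_cast
          ring

/-- E0'' for the Schwinger functions of an OS measure (from OS0's exponential moments and OS1). [cite: GlimmJaffeQP1987, §19.1 Prop. 19.1.1–19.1.2] -/
theorem IsOSMeasure.hasProductGrowth [NeZero d] (hμ : IsOSMeasure d μ)
    {S : SchwingerFamily (EuclideanSpace ℝ (Fin d))} (hS : IsSchwingerFamilyOf μ S) :
    S.HasProductGrowth := by
  haveI := hμ.isProbabilityMeasure
  obtain ⟨p, c, h1⟩ := hμ.os1
  exact hS.hasProductGrowth h1 hμ.os0.1

end Measure

end Literature.MathematicalPhysics.QuantumLattice
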